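import Summits.AtomisticToContinuum.FouriersLaw.Theorems.OddSectorIrreversibilitySubBallisticWindowAbelGreenKubo
import Mathlib.Analysis.SpecialFunctions.Pow.Asymptotics

/-!
# `SubBallisticWindow` (stmt-AtomisticToContinuum-14070): the Abel–Green–Kubo form of the crux, part 3 (converse)

Support file for crux `Summit.AtomisticToContinuum.FouriersLaw.Theses.OddSectorIrreversibility.SubBallisticWindow`
(E2 of route OddSectorIrreversibility). Part 2 (`…SubBallisticWindowAbelGreenKubo.lean`) proved
`(N-uniform Abel bound r ‖u_r‖²_{L²(μ_T)} ≤ C ℓ Z, r ∈ (0,1]) → SubBallisticWindow` for the Abel (resolvent)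
corrector `u_r(x) = ∫_{(0,∞)} e^{-rt} J_B(Φ_t x) dt` of the CLOSED chain. This part proves the CONVERSE and
records the equivalence:

* `abel_eq_laplace_window` — integration by parts on `(0, ∞)`: `u_r(x) = r ∫_{(0,∞)} e^{-rt} Q_B(t)(x) dt`, the
  Abel corrector is the exponentially weighted average of the windows `Q_B(t)(x) = ∫_{(0,t]} J_B(Φ_s x) ds`;
* `sq_laplace_window_le` — Jensen for the probability density `r e^{-rt} dt`;
* `abel_sq_integral_le` — with Tonelli: `V_B(t) ≤ M (1+t)` for all `t ≥ 0` implies `r ‖u_r‖² ≤ M (1 + r) ≤ 2M`;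
* `abelBound_of_subBallisticWindow`, `subBallisticWindow_iff_abelBound` — crux vocabulary.

So E2 is EXACTLY the N-, block- and cutoff-uniform bound `r ‖u_r‖²_{L²(μ_T)} ≤ C ℓ Z` — on paper (pairing identity
`⟨J_B, u_r⟩_{μ_T} = r ‖u_r‖²`, not formalised here) the boundedness of the Abel-regularised finite-volume Green–Kubo
integral of the block current, i.e. bounded block conductivity, open in print for every deterministic anharmonic lattice (BonettoLebowitzReyBellet2000 §6.3).
Nothing here closes the item. Lead c8 of line `Sketch`, 2026-08-17.
-/

noncomputable section

namespace Summit.AtomisticToContinuum.FouriersLaw.Theorems.SubBallisticWindow.AbelGreenKubo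

open MeasureTheory Filter Topology Set
open scoped NNReal ENNReal
open Literature.MathematicalPhysics.KineticTheory.HeatConduction
open Summit.AtomisticToContinuum.FouriersLaw.Theorems.ClosedConeSensitivity.Negative.ZeroFrictionDictionary
open Summit.AtomisticToContinuum.FouriersLaw.Theorems.OddSectorWitness

variable {ω₂ lam β : ℝ} (hω : 0 < ω₂) (hl : 0 ≤ lam) (hβ : 0 ≤ β)
include hω hl hβ

/-! ## §4.2 The Abel corrector is the exponentially weighted average of the windows -/

section Pointwise

variable (γ : ℝ) (N k₁ k₂ : ℕ)

/-- `e^{-rt} Q_B(t)(x)` is integrable on `(0,∞)`, dominated by `K(x) t e^{-rt}`. [folklore] -/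
theorem integrableOn_exp_mul_window {r : ℝ} (hr : 0 < r) (x : PhaseSpace N) :
    IntegrableOn (fun t : ℝ => Real.exp (-r * t) * window ω₂ lam β γ N k₁ k₂ t x) (Ioi 0) := by
  set K := (N * (N * ((3 + β) / 2 * (1 + (pinnedChain ω₂ lam β γ).hamiltonian N x) ^ 2)) : ℝ) with hK
  have hdom : IntegrableOn (fun t : ℝ => K * (t ^ 1 * Real.exp (-r * t))) (Ioi 0) :=
    (integrableOn_pow_mul_exp_neg_mul 1 hr).const_mul K
  have hc : Continuous fun t : ℝ => Real.exp (-r * t) * window ω₂ lam β γ N k₁ k₂ t x :=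
    (Real.continuous_exp.comp (continuous_const.mul continuous_id)).mul
      (TimeAveragedCorrector.continuous_window_time hω hl hβ γ N k₁ k₂ x)
  refine hdom.mono' hc.aestronglyMeasurable ((ae_restrict_iff' measurableSet_Ioi).2 (ae_of_all _ fun t ht => ?_))
  have ht0 : 0 < t := ht
  rw [norm_mul, Real.norm_eq_abs, Real.norm_eq_abs, abs_of_pos (Real.exp_pos _), pow_one]
  have hw := abs_window_le hω hl hβ N γ k₁ k₂ ht0.le x
  rw [← hK] at hw
  calc Real.exp (-r * t) * |window ω₂ lam β γ N k₁ k₂ t x| ≤ Real.exp (-r * t) * (t * K) :=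
        mul_le_mul_of_nonneg_left hw (Real.exp_pos _).le
    _ = K * (t * Real.exp (-r * t)) := by ring

/-- `e^{-rt} Q_B(t)(x)²` is integrable on `(0,∞)`, dominated by `K(x)² t² e^{-rt}`. [folklore] -/
theorem integrableOn_exp_mul_window_sq {r : ℝ} (hr : 0 < r) (x : PhaseSpace N) :
    IntegrableOn (fun t : ℝ => Real.exp (-r * t) * (window ω₂ lam β γ N k₁ k₂ t x) ^ 2) (Ioi 0) := by
  set K := (N * (N * ((3 + β) / 2 * (1 + (pinnedChain ω₂ lam β γ).hamiltonian N x) ^ 2)) : ℝ) with hK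
  have hdom : IntegrableOn (fun t : ℝ => K ^ 2 * (t ^ 2 * Real.exp (-r * t))) (Ioi 0) :=
    (integrableOn_pow_mul_exp_neg_mul 2 hr).const_mul (K ^ 2)
  have hc : Continuous fun t : ℝ => Real.exp (-r * t) * (window ω₂ lam β γ N k₁ k₂ t x) ^ 2 :=
    (Real.continuous_exp.comp (continuous_const.mul continuous_id)).mul
      ((TimeAveragedCorrector.continuous_window_time hω hl hβ γ N k₁ k₂ x).pow 2)
  refine hdom.mono' hc.aestronglyMeasurable ((ae_restrict_iff' measurableSet_Ioi).2 (ae_of_all _ fun t ht => ?_))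
  have ht0 : 0 < t := ht
  rw [norm_mul, Real.norm_eq_abs, Real.norm_eq_abs, abs_of_pos (Real.exp_pos _), abs_pow]
  have hw := abs_window_le hω hl hβ N γ k₁ k₂ ht0.le x
  rw [← hK] at hw
  have hw2 : |window ω₂ lam β γ N k₁ k₂ t x| ^ 2 ≤ (t * K) ^ 2 := pow_le_pow_left₀ (abs_nonneg _) hw 2
  calc Real.exp (-r * t) * |window ω₂ lam β γ N k₁ k₂ t x| ^ 2 ≤ Real.exp (-r * t) * (t * K) ^ 2 :=
        mul_le_mul_of_nonneg_left hw2 (Real.exp_pos _).le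
    _ = K ^ 2 * (t ^ 2 * Real.exp (-r * t)) := by ring

/-- **Integration by parts on `(0, ∞)`**: the Abel corrector is the exponentially weighted average of the
windows, `u_r(x) = r ∫_{(0,∞)} e^{-rt} Q_B(t)(x) dt` (`d/dt Q_B(t)(x) = J_B(Φ_t x)`, `Q_B(0) = 0`,
`e^{-rt} Q_B(t) → 0`). [folklore] -/
theorem abel_eq_laplace_window {r : ℝ} (hr : 0 < r) (x : PhaseSpace N) :
    (∫ t in Ioi (0:ℝ), Real.exp (-r * t) * blockCurrent ω₂ lam β γ N k₁ k₂ (detFlow ω₂ lam β N t x)) =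
      r * ∫ t in Ioi (0:ℝ), Real.exp (-r * t) * window ω₂ lam β γ N k₁ k₂ t x := by
  set K := (N * (N * ((3 + β) / 2 * (1 + (pinnedChain ω₂ lam β γ).hamiltonian N x) ^ 2)) : ℝ) with hK
  set j : ℝ → ℝ := fun t => blockCurrent ω₂ lam β γ N k₁ k₂ (detFlow ω₂ lam β N t x) with hj
  set W : ℝ → ℝ := fun t => window ω₂ lam β γ N k₁ k₂ t x with hW
  have hjc : Continuous j := (continuous_blockCurrent N γ k₁ k₂).comp (continuous_detFlow_time hω hl hβ N x)
  have hWc : Continuous W := TimeAveragedCorrector.continuous_window_time hω hl hβ γ N k₁ k₂ x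
  have hec : Continuous fun t : ℝ => Real.exp (-r * t) := Real.continuous_exp.comp (continuous_const.mul continuous_id)
  -- derivatives on `(0, ∞)`
  have hWd : ∀ t ∈ Ioi (0:ℝ), HasDerivAt W (j t) t := fun t ht => by
    have hprim : HasDerivAt (fun u => ∫ s in (0:ℝ)..u, j s) (j t) t :=
      TimeAveragedCorrector.hasDerivAt_primitive hjc 0 t
    refine hprim.congr_of_eventuallyEq ?_
    filter_upwards [Ioi_mem_nhds ht] with u hu
    have hu0 : (0:ℝ) ≤ u := le_of_lt hu
    simp only [hW, TimeAveragedCorrector.window_eq_intervalIntegral γ N k₁ k₂ u x, max_eq_left hu0, hj]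
  have hud : ∀ t ∈ Ioi (0:ℝ), HasDerivAt (fun t : ℝ => Real.exp (-r * t)) (-r * Real.exp (-r * t)) t :=
    fun t _ => by
      have h := ((hasDerivAt_id' t).const_mul (-r)).exp
      refine h.congr_deriv ?_
      ring
  -- integrability of `u v'` and `u' v`
  have huv' : IntegrableOn ((fun t : ℝ => Real.exp (-r * t)) * j) (Ioi 0) :=
    integrableOn_abelIntegrand hω hl hβ γ N k₁ k₂ hr x 0
  have hu'v : IntegrableOn ((fun t : ℝ => -r * Real.exp (-r * t)) * W) (Ioi 0) := by
    have h := (integrableOn_exp_mul_window hω hl hβ γ N k₁ k₂ hr x).const_mul (-r)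
    refine (integrableOn_congr_fun (fun t _ => ?_) measurableSet_Ioi).2 h
    simp only [Pi.mul_apply, hW]
    ring
  -- boundary values
  have h_zero : Tendsto ((fun t : ℝ => Real.exp (-r * t)) * W) (𝓝[>] 0) (𝓝 0) := by
    have hc : Continuous fun t : ℝ => Real.exp (-r * t) * W t := hec.mul hWc
    have h0 : Real.exp (-r * 0) * W 0 = 0 := by
      simp only [hW, window_of_nonpos γ N k₁ k₂ le_rfl x, mul_zero]
    have h := hc.tendsto 0
    rw [h0] at h
    exact h.mono_left nhdsWithin_le_nhds
  have h_infty : Tendsto ((fun t : ℝ => Real.exp (-r * t)) * W) atTop (𝓝 0) := by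
    have hlim : Tendsto (fun t : ℝ => K * (t ^ (1:ℝ) * Real.exp (-r * t))) atTop (𝓝 0) := by
      have h := (tendsto_rpow_mul_exp_neg_mul_atTop_nhds_zero 1 r hr).const_mul K
      rwa [mul_zero] at h
    refine squeeze_zero_norm' ?_ hlim
    filter_upwards [eventually_ge_atTop (0:ℝ)] with t ht
    rw [Real.rpow_one, Pi.mul_apply, norm_mul, Real.norm_eq_abs, Real.norm_eq_abs, abs_of_pos (Real.exp_pos _)]
    have hw := abs_window_le hω hl hβ N γ k₁ k₂ ht x
    rw [← hK] at hw
    calc Real.exp (-r * t) * |window ω₂ lam β γ N k₁ k₂ t x| ≤ Real.exp (-r * t) * (t * K) :=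
          mul_le_mul_of_nonneg_left hw (Real.exp_pos _).le
      _ = K * (t * Real.exp (-r * t)) := by ring
  have hparts := integral_Ioi_mul_deriv_eq_deriv_mul hud hWd huv' hu'v h_zero h_infty
  rw [hparts, sub_self, zero_sub, ← integral_neg, ← integral_const_mul]
  refine integral_congr_ae (ae_of_all _ fun t => ?_)
  simp only [hW]
  ring

/-- **Jensen for the exponential density**: `(r ∫_{(0,∞)} e^{-rt} Q_B(t) dt)² ≤ r ∫_{(0,∞)} e^{-rt} Q_B(t)² dt`
(`∫_{(0,∞)} r e^{-rt} dt = 1`; expand `0 ≤ ∫ r e^{-rt} (Q_B(t) - m)²`). [folklore] -/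
theorem sq_laplace_window_le {r : ℝ} (hr : 0 < r) (x : PhaseSpace N) :
    (r * ∫ t in Ioi (0:ℝ), Real.exp (-r * t) * window ω₂ lam β γ N k₁ k₂ t x) ^ 2 ≤
      r * ∫ t in Ioi (0:ℝ), Real.exp (-r * t) * (window ω₂ lam β γ N k₁ k₂ t x) ^ 2 := by
  set W : ℝ → ℝ := fun t => window ω₂ lam β γ N k₁ k₂ t x with hW
  set m : ℝ := r * ∫ t in Ioi (0:ℝ), Real.exp (-r * t) * W t with hm
  have hI0 : IntegrableOn (fun t : ℝ => Real.exp (-r * t)) (Ioi 0) := exp_neg_integrableOn_Ioi 0 hr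
  have hI1 : IntegrableOn (fun t : ℝ => Real.exp (-r * t) * W t) (Ioi 0) :=
    integrableOn_exp_mul_window hω hl hβ γ N k₁ k₂ hr x
  have hI2 : IntegrableOn (fun t : ℝ => Real.exp (-r * t) * (W t) ^ 2) (Ioi 0) :=
    integrableOn_exp_mul_window_sq hω hl hβ γ N k₁ k₂ hr x
  have hnn : 0 ≤ ∫ t in Ioi (0:ℝ), r * (Real.exp (-r * t) * (W t - m) ^ 2) :=
    setIntegral_nonneg measurableSet_Ioi fun t _ => by positivity
  have hJ1 : IntegrableOn (fun t : ℝ => r * (Real.exp (-r * t) * (W t) ^ 2)) (Ioi 0) := hI2.const_mul r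
  have hJ2 : IntegrableOn (fun t : ℝ => 2 * m * r * (Real.exp (-r * t) * W t)) (Ioi 0) := hI1.const_mul _
  have hJ3 : IntegrableOn (fun t : ℝ => m ^ 2 * r * Real.exp (-r * t)) (Ioi 0) := hI0.const_mul _
  have hJ12 : IntegrableOn (fun t : ℝ => r * (Real.exp (-r * t) * (W t) ^ 2) - 2 * m * r * (Real.exp (-r * t) * W t))
      (Ioi 0) := hJ1.sub hJ2
  have hexp : ∫ t in Ioi (0:ℝ), r * (Real.exp (-r * t) * (W t - m) ^ 2) =
      r * (∫ t in Ioi (0:ℝ), Real.exp (-r * t) * (W t) ^ 2) -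
        2 * m * r * (∫ t in Ioi (0:ℝ), Real.exp (-r * t) * W t) +
          m ^ 2 * r * ∫ t in Ioi (0:ℝ), Real.exp (-r * t) := by
    have hpt : ∀ t : ℝ, r * (Real.exp (-r * t) * (W t - m) ^ 2) =
        r * (Real.exp (-r * t) * (W t) ^ 2) - 2 * m * r * (Real.exp (-r * t) * W t) +
          m ^ 2 * r * Real.exp (-r * t) := fun t => by ring
    simp_rw [hpt]
    rw [integral_add hJ12 hJ3, integral_sub hJ1 hJ2, integral_const_mul, integral_const_mul, integral_const_mul]
  rw [integral_exp_neg_mul_Ioi_eq hr] at hexp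
  have hm2 : 2 * m * r * (∫ t in Ioi (0:ℝ), Real.exp (-r * t) * W t) = 2 * m ^ 2 := by
    rw [hm]; ring
  have hm3 : m ^ 2 * r * (1 / r) = m ^ 2 := by field_simp
  rw [hm2, hm3] at hexp
  linarith

end Pointwise

/-! ## §4.3 Tonelli against the Gibbs weight and the converse bound -/

section L2

variable (γ : ℝ) (N k₁ k₂ : ℕ)

/-- **Tonelli for the exponentially weighted windows.** If `∫ Q_B(t)² dμ_T ≤ M (1 + t)` for all `t ≥ 0`
(`r > 0`), then `x ↦ ∫_{(0,∞)} e^{-rt} Q_B(t)(x)² dt` is `μ_T`-integrable and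
`∫ (r ∫_{(0,∞)} e^{-rt} Q_B(t)(x)² dt) dμ_T(x) ≤ M (1 + 1/r)`. [folklore] -/
theorem integral_laplace_window_sq_le {T : ℝ} (hT : 0 < T) {r : ℝ} (hr : 0 < r) {M : ℝ}
    (hV : ∀ t : ℝ, 0 ≤ t →
      ∫ x, (window ω₂ lam β γ N k₁ k₂ t x) ^ 2 ∂(gibbsWeight ω₂ lam β γ N T) ≤ M * (1 + t)) :
    Integrable (fun x => ∫ t in Ioi (0:ℝ), Real.exp (-r * t) * (window ω₂ lam β γ N k₁ k₂ t x) ^ 2)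
      (gibbsWeight ω₂ lam β γ N T) ∧
    ∫ x, (r * ∫ t in Ioi (0:ℝ), Real.exp (-r * t) * (window ω₂ lam β γ N k₁ k₂ t x) ^ 2)
      ∂(gibbsWeight ω₂ lam β γ N T) ≤ M * (1 + 1 / r) := by
  haveI := isFiniteMeasure_gibbsWeight hω hl hβ γ N hT
  set μ := gibbsWeight ω₂ lam β γ N T with hμ
  set K : PhaseSpace N → ℝ := fun x =>
    (N * (N * ((3 + β) / 2 * (1 + (pinnedChain ω₂ lam β γ).hamiltonian N x) ^ 2)) : ℝ) with hK
  set F : ℝ × PhaseSpace N → ℝ := fun p => Real.exp (-r * p.1) * (window ω₂ lam β γ N k₁ k₂ p.1 p.2) ^ 2 with hF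
  -- measurability of the integrand on `(0,∞) × phase space`
  have hFm : Measurable F := by
    have h1 : Measurable fun p : ℝ × PhaseSpace N => Real.exp (-r * p.1) :=
      (Real.continuous_exp.measurable).comp (measurable_fst.const_mul (-r))
    exact h1.mul ((TimeAveragedCorrector.measurable_window_uncurry hω hl hβ γ N k₁ k₂).pow_const 2)
  -- domination by the product `(t² e^{-rt}) · K(x)²`
  have hK2 : Integrable (fun x => (K x) ^ 2) μ := by
    have h4 := (integrable_one_add_hamiltonian_pow hω hl hβ γ N hT 4).const_mul ((N * (N * ((3 + β) / 2))) ^ 2)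
    refine h4.congr (Eventually.of_forall fun x => ?_)
    simp only [hK]
    ring
  have hdom : Integrable (fun p : ℝ × PhaseSpace N => (p.1 ^ 2 * Real.exp (-r * p.1)) * (K p.2) ^ 2)
      ((volume.restrict (Ioi (0:ℝ))).prod μ) :=
    (integrableOn_pow_mul_exp_neg_mul 2 hr).mul_prod hK2
  have hbound : ∀ p : ℝ × PhaseSpace N, ‖F p‖ ≤ (p.1 ^ 2 * Real.exp (-r * p.1)) * (K p.2) ^ 2 := fun p => by
    simp only [hF]
    rw [norm_mul, Real.norm_eq_abs, Real.norm_eq_abs, abs_of_pos (Real.exp_pos _), abs_pow]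
    have hw := abs_window_le_abs hω hl hβ γ N k₁ k₂ p.1 p.2
    have hw2 : |window ω₂ lam β γ N k₁ k₂ p.1 p.2| ^ 2 ≤ (|p.1| * K p.2) ^ 2 :=
      pow_le_pow_left₀ (abs_nonneg _) hw 2
    calc Real.exp (-r * p.1) * |window ω₂ lam β γ N k₁ k₂ p.1 p.2| ^ 2
        ≤ Real.exp (-r * p.1) * (|p.1| * K p.2) ^ 2 := mul_le_mul_of_nonneg_left hw2 (Real.exp_pos _).le
      _ = (p.1 ^ 2 * Real.exp (-r * p.1)) * (K p.2) ^ 2 := by rw [mul_pow, sq_abs]; ring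
  have hInt : Integrable F ((volume.restrict (Ioi (0:ℝ))).prod μ) :=
    hdom.mono' hFm.aestronglyMeasurable (Eventually.of_forall hbound)
  refine ⟨hInt.integral_prod_right, ?_⟩
  -- swap the integrals
  have hswap : ∫ x, (r * ∫ t in Ioi (0:ℝ), F (t, x)) ∂μ = r * ∫ t in Ioi (0:ℝ), ∫ x, F (t, x) ∂μ := by
    rw [integral_const_mul, ← integral_integral_swap hInt]
  have hslice : ∀ t ∈ Ioi (0:ℝ), ∫ x, F (t, x) ∂μ ≤ Real.exp (-r * t) * (M * (1 + t)) := fun t ht => by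
    simp only [hF]
    rw [integral_const_mul]
    exact mul_le_mul_of_nonneg_left (hV t (le_of_lt ht)) (Real.exp_pos _).le
  have hR : IntegrableOn (fun t : ℝ => Real.exp (-r * t) * (M * (1 + t))) (Ioi 0) := by
    have h0 := (exp_neg_integrableOn_Ioi 0 hr).const_mul M
    have h1 := (integrableOn_pow_mul_exp_neg_mul 1 hr).const_mul M
    refine (integrableOn_congr_fun (fun t _ => ?_) measurableSet_Ioi).1 (h0.add h1)
    simp only [Pi.add_apply, pow_one]
    ring
  have hmono : ∫ t in Ioi (0:ℝ), ∫ x, F (t, x) ∂μ ≤ ∫ t in Ioi (0:ℝ), Real.exp (-r * t) * (M * (1 + t)) :=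
    setIntegral_mono_on hInt.integral_prod_left hR measurableSet_Ioi hslice
  have hval : ∫ t in Ioi (0:ℝ), Real.exp (-r * t) * (M * (1 + t)) = M * (1 / r + 1 / r ^ 2) := by
    have hpt : ∀ t : ℝ, Real.exp (-r * t) * (M * (1 + t)) = M * Real.exp (-r * t) + M * (t * Real.exp (-r * t)) :=
      fun t => by ring
    simp_rw [hpt]
    rw [integral_add ((exp_neg_integrableOn_Ioi 0 hr).const_mul M)
      (((integrableOn_pow_mul_exp_neg_mul 1 hr).congr_fun (fun t _ => by rw [pow_one]) measurableSet_Ioi).const_mul M),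
      integral_const_mul, integral_const_mul, integral_exp_neg_mul_Ioi_eq hr, integral_mul_exp_neg_mul_Ioi_eq hr]
    ring
  have hfinal : r * ∫ t in Ioi (0:ℝ), ∫ x, F (t, x) ∂μ ≤ r * (M * (1 / r + 1 / r ^ 2)) :=
    mul_le_mul_of_nonneg_left (hmono.trans (le_of_eq hval)) hr.le
  have hr' : r * (M * (1 / r + 1 / r ^ 2)) = M * (1 + 1 / r) := by field_simp
  calc ∫ x, (r * ∫ t in Ioi (0:ℝ), Real.exp (-r * t) * (window ω₂ lam β γ N k₁ k₂ t x) ^ 2) ∂μ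
      = ∫ x, (r * ∫ t in Ioi (0:ℝ), F (t, x)) ∂μ := by simp only [hF]
    _ = r * ∫ t in Ioi (0:ℝ), ∫ x, F (t, x) ∂μ := hswap
    _ ≤ r * (M * (1 / r + 1 / r ^ 2)) := hfinal
    _ = M * (1 + 1 / r) := hr'

/-- **The converse bound** (flow vocabulary): if `∫ Q_B(t)² dμ_T ≤ M (1 + t)` for all `t ≥ 0` (`M ≥ 0`), then for
every `r ∈ (0,1]` the Abel corrector satisfies `r ∫ u_r² dμ_T ≤ 2 M`
(`u_r = r ∫ e^{-rt} Q_B(t) dt` pointwise, Jensen, Tonelli: `r ‖u_r‖² ≤ M (r + 1)`). [folklore] -/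
theorem abel_sq_integral_le {T : ℝ} (hT : 0 < T) {r : ℝ} (hr : 0 < r) (hr1 : r ≤ 1) {M : ℝ} (hM : 0 ≤ M)
    (hV : ∀ t : ℝ, 0 ≤ t →
      ∫ x, (window ω₂ lam β γ N k₁ k₂ t x) ^ 2 ∂(gibbsWeight ω₂ lam β γ N T) ≤ M * (1 + t)) :
    r * ∫ x, (∫ t in Ioi (0:ℝ), Real.exp (-r * t) *
        blockCurrent ω₂ lam β γ N k₁ k₂ (detFlow ω₂ lam β N t x)) ^ 2 ∂(gibbsWeight ω₂ lam β γ N T) ≤ 2 * M := by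
  haveI := isFiniteMeasure_gibbsWeight hω hl hβ γ N hT
  have hTon := integral_laplace_window_sq_le hω hl hβ γ N k₁ k₂ hT hr hV
  -- pointwise: `u_r(x)² ≤ r ∫ e^{-rt} Q_B(t)(x)² dt`
  have hpt : ∀ x, (∫ t in Ioi (0:ℝ), Real.exp (-r * t) *
      blockCurrent ω₂ lam β γ N k₁ k₂ (detFlow ω₂ lam β N t x)) ^ 2 ≤
      r * ∫ t in Ioi (0:ℝ), Real.exp (-r * t) * (window ω₂ lam β γ N k₁ k₂ t x) ^ 2 := fun x => by
    rw [abel_eq_laplace_window hω hl hβ γ N k₁ k₂ hr x]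
    exact sq_laplace_window_le hω hl hβ γ N k₁ k₂ hr x
  have hmono := integral_mono_of_nonneg (μ := gibbsWeight ω₂ lam β γ N T)
    (Eventually.of_forall fun x => sq_nonneg _) (hTon.1.const_mul r) (Eventually.of_forall hpt)
  have h1 : r * ∫ x, (∫ t in Ioi (0:ℝ), Real.exp (-r * t) *
      blockCurrent ω₂ lam β γ N k₁ k₂ (detFlow ω₂ lam β N t x)) ^ 2 ∂(gibbsWeight ω₂ lam β γ N T) ≤
      r * (M * (1 + 1 / r)) :=
    mul_le_mul_of_nonneg_left (hmono.trans hTon.2) hr.le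
  have h2 : r * (M * (1 + 1 / r)) = M * (r + 1) := by field_simp
  rw [h2] at h1
  nlinarith

end L2

/-! ## §4.4 Crux vocabulary: the converse and the equivalence -/

section Crux

open Summit.AtomisticToContinuum.FouriersLaw.Theses.OddSectorIrreversibility

omit hω hl hβ in
/-- **`SubBallisticWindow` implies the Abel (Green–Kubo resolvent) bound.** If E2 holds with constant `C`, then
for every `N`, block and `r ∈ (0,1]` the Abel corrector `u_r(x) = ∫_{(0,∞)} e^{-rt} (P⁰_t J_B)(x) dt` of the
closed chain satisfies `r ∫ u_r² dμ_T ≤ 2 max(C,0) (k₂ - k₁) Z` (`abel_sq_integral_le` with `M = max(C,0) ℓ Z`).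
[folklore] -/
theorem abelBound_of_subBallisticWindow : SubBallisticWindow → ∀ ω₂ lam β γ : ℝ, 0 < ω₂ → 0 < lam → 0 < β → 0 < γ → ∀ T : ℝ, 0 < T → ∃ C : ℝ, ∀ (N k₁ k₂ : ℕ), k₁ ≤ k₂ → k₂ + 1 ≤ N → ∀ r : ℝ, 0 < r → r ≤ 1 → let P := pinnedChain ω₂ lam β γ; let P₀ := pinnedChain ω₂ lam β 0; let μT : Measure (PhaseSpace N) := volume.withDensity (fun x : PhaseSpace N => ENNReal.ofReal (Real.exp (-(P.hamiltonian N x) / T))); let JB : PhaseSpace N → ℝ := fun z => ∑ i : Fin N, (if k₁ ≤ i.val ∧ i.val < k₂ then P.bondCurrent N i z else 0); r * ∫ x, (∫ t in Set.Ioi (0 : ℝ), Real.exp (-r * t) * (∫ y, JB y ∂(P₀.transitionKernel N T T t.toNNReal x))) ^ 2 ∂μT ≤ C * ((k₂ : ℝ) - k₁) * ∫ x, Real.exp (-(P.hamiltonian N x) / T) ∂volume := by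
  intro hE2 ω₂ lam β γ hω hl hβ hγ T hT
  obtain ⟨C, hC⟩ := hE2 ω₂ lam β γ hω hl hβ hγ T hT
  refine ⟨2 * max C 0, fun N k₁ k₂ hk hkN r hr hr1 => ?_⟩
  simp only
  set Z := ∫ y, Real.exp (-((pinnedChain ω₂ lam β γ).hamiltonian N y) / T) ∂volume with hZ
  have hZ0 : 0 ≤ Z := integral_nonneg fun _ => (Real.exp_pos _).le
  have hℓ0 : (0 : ℝ) ≤ (k₂ : ℝ) - k₁ := sub_nonneg.mpr (by exact_mod_cast hk)
  have hC0 : 0 ≤ max C 0 := le_max_right _ _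
  have hM : 0 ≤ max C 0 * ((k₂ : ℝ) - k₁) * Z := by positivity
  -- E2 in flow vocabulary: `V_B(t) ≤ M (1 + t)` for all `t ≥ 0`
  have hV : ∀ t : ℝ, 0 ≤ t → ∫ x, (window ω₂ lam β γ N k₁ k₂ t x) ^ 2 ∂(gibbsWeight ω₂ lam β γ N T) ≤
      max C 0 * ((k₂ : ℝ) - k₁) * Z * (1 + t) := fun t ht => by
    have h1 := hC N k₁ k₂ hk hkN t ht
    simp only at h1
    have hdict := Partial.integral_window_kernel_eq hω hl.le hβ.le γ N k₁ k₂ T t (gibbsWeight ω₂ lam β γ N T)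
    simp only [blockCurrent] at hdict
    rw [show (volume.withDensity fun x : PhaseSpace N =>
        ENNReal.ofReal (Real.exp (-((pinnedChain ω₂ lam β γ).hamiltonian N x) / T))) =
        gibbsWeight ω₂ lam β γ N T from rfl, hdict] at h1
    have h2 : ∫ x, (window ω₂ lam β γ N k₁ k₂ t x) ^ 2 ∂(gibbsWeight ω₂ lam β γ N T) ≤
        C * (1 + t) * ((k₂ : ℝ) - k₁) * Z := by
      simp only [window, blockCurrent]
      exact h1
    refine h2.trans ?_
    have ht1 : 0 ≤ 1 + t := by linarith
    calc C * (1 + t) * ((k₂ : ℝ) - k₁) * Z = C * ((1 + t) * ((k₂ : ℝ) - k₁) * Z) := by ring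
      _ ≤ max C 0 * ((1 + t) * ((k₂ : ℝ) - k₁) * Z) := mul_le_mul_of_nonneg_right (le_max_left _ _) (by positivity)
      _ = max C 0 * ((k₂ : ℝ) - k₁) * Z * (1 + t) := by ring
  have hmain := abel_sq_integral_le hω hl.le hβ.le γ N k₁ k₂ hT hr hr1 hM hV
  -- back to the kernel vocabulary
  rw [show (volume.withDensity fun x : PhaseSpace N =>
      ENNReal.ofReal (Real.exp (-((pinnedChain ω₂ lam β γ).hamiltonian N x) / T))) =
      gibbsWeight ω₂ lam β γ N T from rfl]
  have hdictA : ∀ x : PhaseSpace N, (∫ t in Ioi (0:ℝ), Real.exp (-r * t) *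
      (∫ y, blockCurrent ω₂ lam β γ N k₁ k₂ y ∂((pinnedChain ω₂ lam β 0).transitionKernel N T T t.toNNReal x))) =
      ∫ t in Ioi (0:ℝ), Real.exp (-r * t) * blockCurrent ω₂ lam β γ N k₁ k₂ (detFlow ω₂ lam β N t x) :=
    fun x => integral_abel_kernel_eq hω hl.le hβ.le γ N k₁ k₂ T r x
  have hIeq : ∫ x, (∫ t in Ioi (0:ℝ), Real.exp (-r * t) *
      (∫ y, blockCurrent ω₂ lam β γ N k₁ k₂ y ∂((pinnedChain ω₂ lam β 0).transitionKernel N T T t.toNNReal x))) ^ 2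
        ∂(gibbsWeight ω₂ lam β γ N T) =
      ∫ x, (∫ t in Ioi (0:ℝ), Real.exp (-r * t) *
        blockCurrent ω₂ lam β γ N k₁ k₂ (detFlow ω₂ lam β N t x)) ^ 2 ∂(gibbsWeight ω₂ lam β γ N T) :=
    integral_congr_ae (Eventually.of_forall fun x => by simp only [hdictA x])
  simp only [blockCurrent] at hIeq hmain
  rw [hIeq]
  calc r * ∫ x, (∫ t in Ioi (0:ℝ), Real.exp (-r * t) *
        ∑ i : Fin N, (if k₁ ≤ i.val ∧ i.val < k₂ then
          (pinnedChain ω₂ lam β γ).bondCurrent N i (detFlow ω₂ lam β N t x) else 0)) ^ 2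
          ∂(gibbsWeight ω₂ lam β γ N T)
      ≤ 2 * (max C 0 * ((k₂ : ℝ) - k₁) * Z) := hmain
    _ = 2 * max C 0 * ((k₂ : ℝ) - k₁) * Z := by ring

omit hω hl hβ in
/-- **`SubBallisticWindow` ⟺ the N-uniform Abel–Green–Kubo bound.** The crux E2 is EQUIVALENT to: for all
parameters `> 0` and `T > 0` there is `C` with `r ∫ u_r² dμ_T ≤ C (k₂ - k₁) Z` for every `N`, every block
`[k₁,k₂)` (`k₂ + 1 ≤ N`) and every `r ∈ (0,1]`, where `u_r(x) = ∫_{(0,∞)} e^{-rt} (P⁰_t J_B)(x) dt` is the Abel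
corrector of the CLOSED chain (on paper, by `⟨J_B, u_r⟩_{μ_T} = r ‖u_r‖²_{L²(μ_T)}`, this is the N-, block- and
cutoff-uniform boundedness of the Abel-regularised finite-volume Green–Kubo integral of the block current — bounded
block conductivity, the textbook form of the open problem, BonettoLebowitzReyBellet2000 §6.3). [folklore] -/
theorem subBallisticWindow_iff_abelBound : SubBallisticWindow ↔ (∀ ω₂ lam β γ : ℝ, 0 < ω₂ → 0 < lam → 0 < β → 0 < γ → ∀ T : ℝ, 0 < T → ∃ C : ℝ, ∀ (N k₁ k₂ : ℕ), k₁ ≤ k₂ → k₂ + 1 ≤ N → ∀ r : ℝ, 0 < r → r ≤ 1 → let P := pinnedChain ω₂ lam β γ; let P₀ := pinnedChain ω₂ lam β 0; let μT : Measure (PhaseSpace N) := volume.withDensity (fun x : PhaseSpace N => ENNReal.ofReal (Real.exp (-(P.hamiltonian N x) / T))); let JB : PhaseSpace N → ℝ := fun z => ∑ i : Fin N, (if k₁ ≤ i.val ∧ i.val < k₂ then P.bondCurrent N i z else 0); r * ∫ x, (∫ t in Set.Ioi (0 : ℝ), Real.exp (-r * t) * (∫ y, JB y ∂(P₀.transitionKernel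 N T T t.toNNReal x))) ^ 2 ∂μT ≤ C * ((k₂ : ℝ) - k₁) * ∫ x, Real.exp (-(P.hamiltonian N x) / T) ∂volume) :=
  ⟨abelBound_of_subBallisticWindow, subBallisticWindow_of_abelBound⟩

end Crux

end Summit.AtomisticToContinuum.FouriersLaw.Theorems.SubBallisticWindow.AbelGreenKubo

end
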